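import Summits.ResolutionOfSingularities.ResolutionOfSingularities.Theorems.FrobeniusLadderFInjectiveMacaulayficationMonomialChartPresentationKernel
import HarnessLib

/-!
# (C1) registered stub `stub_monomialChartPresentation`: the monomial chart presentation for a PRIME hypersurface
# (crux `FInjectiveMacaulayfication`, skeleton v17 §18 CN engine)

Closes the REGISTERED stub (C1) `stub_monomialChartPresentation` of crux stmt-ResolutionOfSingularities-15315 (skeleton v17
`458ab602` §18, planner text `L/w45a/CNEngineSig.lean` (C1)) from res-L1-w45a-stub-1's landed presentation
(`MonomialChartPresentationKernel.exists_monomialChartPresentation`, p493383; `…Range`, p491807). [OURS · L1 W4.5a]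

The one difference: stub-1's kernel inclusion `(g) ⊆ ker Ψ` assumes the decidable divisibility `hunit : x^{Σ dᵢ•aᵢ} ∣ (x^m)^N`;
the registered stub assumes instead that `(f)` is PRIME with no `x̄ⱼ = 0` — then `L = R̄[1/x̄^m]` is a domain, `Ψ(Y^d) ≠ 0`, and
`Ψ(Y^d)·Ψ(g) = Ψ(θ f) = f̄/1 = 0` forces `Ψ(g) = 0` (`psi_g_eq_zero_of_isPrime`). The rest is stub-1's assembly verbatim
(`exists_monomialChartPresentation_of_isPrime`), followed by the repackaging into the registered shape: a choice of the chart
exponents `a i ∈ A`, `Ideal.map_span`, `RingEquiv.ofBijective`, `Subalgebra.equivOfEq`. No definitions, no named facts. [folklore]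
-/

set_option linter.dupNamespace false

noncomputable section

open MvPolynomial Literature.AlgebraicGeometry.Resolution

namespace Summit.ResolutionOfSingularities.ResolutionOfSingularities.Theorems.FInjectiveMacaulayfication.MonomialChartPresentationPrime

open Summit.ResolutionOfSingularities.ResolutionOfSingularities.Theorems.FInjectiveMacaulayfication

variable {n : ℕ} {k : Type} [Field k]

section Presentation

variable (f : MvPolynomial (Fin n) k) (V : Matrix (Fin n) (Fin n) ℕ) (hV : IsUnit (V.map (Nat.cast : ℕ → ℤ)).det)
  (m : Fin n →₀ ℕ) (a : Fin n → (Fin n →₀ ℕ))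
  (hgen : ∀ i : Fin n, (Finsupp.equivFunOnFinite.symm (V.mulVec ⇑(a i)) : Fin n →₀ ℕ) =
    Finsupp.equivFunOnFinite.symm (V.mulVec ⇑m) + Finsupp.single i 1)
  (A : Finset (Fin n →₀ ℕ)) (haA : ∀ i, a i ∈ A)
  (hge : ∀ e ∈ A, (Finsupp.equivFunOnFinite.symm (V.mulVec ⇑m) : Fin n →₀ ℕ) ≤
    Finsupp.equivFunOnFinite.symm (V.mulVec ⇑e))
  (d : Fin n →₀ ℕ) (g : MvPolynomial (Fin n) k)
  (hg : aeval (fun j : Fin n => ∏ i : Fin n, (X i : MvPolynomial (Fin n) k) ^ V i j) f = monomial d (1 : k) * g)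
  (hprime : (Ideal.span {f}).IsPrime) (hXne : ∀ j : Fin n, Ideal.Quotient.mk (Ideal.span {f}) (X j) ≠ 0)
  (hcop : ∀ i : Fin n, ¬ (X i ∣ g))

section
include hV hgen hg hprime hXne

/-- **`(g) ⊆ ker Ψ` for a prime hypersurface**: `Ψ g = 0`, because `Ψ(Y^d)·Ψ(g) = Ψ(θ f) = f̄/1 = 0` in the DOMAIN `R̄[1/x̄^m]`
and `Ψ(Y^d) = ∏ (x̄^{aᵢ}/x̄^m)^{dᵢ} ≠ 0`. [folklore] -/
theorem psi_g_eq_zero_of_isPrime :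
    aeval (fun i : Fin n => algebraMap (MvPolynomial (Fin n) k ⧸ Ideal.span {f})
        (Localization.Away (Ideal.Quotient.mk (Ideal.span {f}) (monomial m (1 : k))))
        (Ideal.Quotient.mk (Ideal.span {f}) (monomial (a i) (1 : k))) *
      IsLocalization.Away.invSelf (Ideal.Quotient.mk (Ideal.span {f}) (monomial m (1 : k)))) g = 0 := by
  classical
  haveI := hprime
  haveI : IsDomain (MvPolynomial (Fin n) k ⧸ Ideal.span {f}) := Ideal.Quotient.isDomain _
  have hmon : ∀ e : Fin n →₀ ℕ, Ideal.Quotient.mk (Ideal.span {f}) (monomial e (1 : k)) ≠ 0 := by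
    intro e
    rw [monomial_eq, C_1, one_mul, Finsupp.prod, map_prod]
    exact Finset.prod_ne_zero_iff.mpr fun j _ => by rw [map_pow]; exact pow_ne_zero _ (hXne j)
  haveI : IsDomain (Localization.Away (Ideal.Quotient.mk (Ideal.span {f}) (monomial m (1 : k)))) :=
    IsLocalization.isDomain_localization (powers_le_nonZeroDivisors_of_noZeroDivisors (hmon m))
  have hinj : Function.Injective (algebraMap (MvPolynomial (Fin n) k ⧸ Ideal.span {f})
      (Localization.Away (Ideal.Quotient.mk (Ideal.span {f}) (monomial m (1 : k))))) :=
    IsLocalization.injective _ (powers_le_nonZeroDivisors_of_noZeroDivisors (hmon m))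
  -- `Ψ(θ f) = f̄/1 = 0`
  have hθ := MonomialChartPresentationRange.psi_theta f V hV m a hgen f
  rw [hg, map_mul, Ideal.Quotient.eq_zero_iff_mem.mpr (Ideal.mem_span_singleton_self f), map_zero] at hθ
  refine (mul_eq_zero.mp hθ).resolve_left ?_
  -- `Ψ(Y^d) ≠ 0`
  rw [aeval_monomial, map_one (algebraMap k (Localization.Away (Ideal.Quotient.mk (Ideal.span {f}) (monomial m (1 : k))))),
    one_mul, Finsupp.prod]
  refine Finset.prod_ne_zero_iff.mpr fun i _ => pow_ne_zero _ (mul_ne_zero ?_ ?_)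
  · exact fun h0 => hmon (a i) (hinj (by rw [h0, map_zero]))
  · exact (IsUnit.of_mul_eq_one (a := IsLocalization.Away.invSelf (S := Localization.Away (Ideal.Quotient.mk (Ideal.span {f})
      (monomial m (1 : k)))) (Ideal.Quotient.mk (Ideal.span {f}) (monomial m (1 : k)))) _
      (by rw [mul_comm]; exact IsLocalization.Away.mul_invSelf _)).ne_zero

end

include hV hgen haA hge hg hprime hXne hcop

/-- **MONOMIAL CHART PRESENTATION for a prime hypersurface** — stub-1's `exists_monomialChartPresentation` with `hunit` replaced
by `(f)` prime and `x̄ⱼ ≠ 0` (assembly copied; only the kernel inclusion differs; conclusion trimmed to the chart-map identity). [folklore] -/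
theorem exists_monomialChartPresentation_of_isPrime :
    ∃ e : (MvPolynomial (Fin n) k ⧸ Ideal.span {g}) →+*
        ↥(Literature.AlgebraicGeometry.Resolution.blowupAlgebra
          (Ideal.span ((fun e : Fin n →₀ ℕ => Ideal.Quotient.mk (Ideal.span {f}) (monomial e (1 : k))) '' (A : Set _)))
          (Ideal.Quotient.mk (Ideal.span {f}) (monomial m (1 : k)))),
      Function.Bijective e ∧
      (∀ q : MvPolynomial (Fin n) k, (e (Ideal.Quotient.mk (Ideal.span {g})
          (aeval (fun j : Fin n => ∏ i : Fin n, (X i : MvPolynomial (Fin n) k) ^ V i j) q))).val =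
        algebraMap (MvPolynomial (Fin n) k ⧸ Ideal.span {f})
          (Localization.Away (Ideal.Quotient.mk (Ideal.span {f}) (monomial m (1 : k))))
          (Ideal.Quotient.mk (Ideal.span {f}) q)) := by
  set R := MvPolynomial (Fin n) k ⧸ Ideal.span {f}
  set u : R := Ideal.Quotient.mk (Ideal.span {f}) (monomial m (1 : k)) with hu
  set L := Localization.Away u
  set Ψ : MvPolynomial (Fin n) k →ₐ[k] L := aeval (fun i : Fin n => algebraMap R L
    (Ideal.Quotient.mk (Ideal.span {f}) (monomial (a i) (1 : k))) * IsLocalization.Away.invSelf u) with hΨ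
  set B := Literature.AlgebraicGeometry.Resolution.blowupAlgebra
    (Ideal.span ((fun e : Fin n →₀ ℕ => Ideal.Quotient.mk (Ideal.span {f}) (monomial e (1 : k))) '' (A : Set _))) u with hB
  have hrange : Set.range (Ψ : MvPolynomial (Fin n) k → L) = (B : Set L) :=
    MonomialChartPresentationRange.range_psi_eq_blowupAlgebra f V hV m a hgen A haA hge
  have hmemB : ∀ q, Ψ q ∈ B := fun q => by
    rw [← SetLike.mem_coe, ← hrange]; exact ⟨q, rfl⟩
  obtain ⟨ψB, hψBval⟩ : ∃ ψ : MvPolynomial (Fin n) k →+* ↥B, ∀ q, (ψ q).val = Ψ q :=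
    ⟨{ toFun := fun q => ⟨Ψ q, hmemB q⟩
       map_one' := Subtype.ext (by simp)
       map_mul' := fun x y => Subtype.ext (by simp)
       map_zero' := Subtype.ext (by simp)
       map_add' := fun x y => Subtype.ext (by simp) }, fun q => rfl⟩
  have hsurj : Function.Surjective ψB := by
    rintro ⟨y, hy⟩
    rw [← SetLike.mem_coe, ← hrange] at hy
    obtain ⟨q, rfl⟩ := hy
    exact ⟨q, Subtype.ext (hψBval q)⟩
  have hker : RingHom.ker ψB = Ideal.span {g} := by
    apply le_antisymm
    · intro h hh
      rw [RingHom.mem_ker, Subtype.ext_iff, hψBval] at hh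
      exact Ideal.mem_span_singleton.mpr (MonomialChartPresentationKernel.dvd_of_psi_eq_zero f V m a hgen d g hg hcop h hh)
    · rw [Ideal.span_le, Set.singleton_subset_iff, SetLike.mem_coe, RingHom.mem_ker, Subtype.ext_iff, hψBval]
      exact psi_g_eq_zero_of_isPrime f V hV m a hgen d g hg hprime hXne
  have hvan : ∀ h ∈ Ideal.span {g}, ψB h = 0 := fun h hh => by
    rw [← hker] at hh
    exact hh
  have hinj : Function.Injective (Ideal.Quotient.lift (Ideal.span {g}) ψB hvan) :=
    RingHom.lift_injective_of_ker_le_ideal (Ideal.span {g}) hvan hker.le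
  have hsφ : Function.Surjective (Ideal.Quotient.lift (Ideal.span {g}) ψB hvan) :=
    Ideal.Quotient.lift_surjective_of_surjective (Ideal.span {g}) hvan hsurj
  have hev : ∀ q : MvPolynomial (Fin n) k,
      (Ideal.Quotient.lift (Ideal.span {g}) ψB hvan) (Ideal.Quotient.mk (Ideal.span {g}) q) = ψB q := fun q =>
    Ideal.Quotient.lift_mk _ _ _
  have hpt : ∀ q : MvPolynomial (Fin n) k,
      Ψ (aeval (fun j : Fin n => ∏ i : Fin n, (X i : MvPolynomial (Fin n) k) ^ V i j) q) =
        algebraMap R L (Ideal.Quotient.mk (Ideal.span {f}) q) := fun q =>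
    MonomialChartPresentationRange.psi_theta f V hV m a hgen q
  refine ⟨Ideal.Quotient.lift (Ideal.span {g}) ψB hvan, ⟨hinj, hsφ⟩, fun q => ?_⟩
  rw [hev, hψBval]
  exact hpt q

end Presentation

/-- (C1) **the registered stub `stub_monomialChartPresentation`** (skeleton v17 §18): stub-1's presentation for a PRIME hypersurface,
repackaged — chart exponents chosen from the registered `hgen`, `(x^A)·R̄ = (x̄^A)` by `Ideal.map_span`, `≃+*` by
`RingEquiv.ofBijective` and `Subalgebra.equivOfEq`. [folklore] -/
theorem stub_monomialChartPresentation : ∀ (k : Type) [Field k] (n : ℕ) (A : Finset (Fin n →₀ ℕ))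
    (V : Matrix (Fin n) (Fin n) ℕ), IsUnit (V.map (Nat.cast : ℕ → ℤ)).det →
    ∀ (m : Fin n →₀ ℕ), m ∈ A →
    (∀ a ∈ A, ∀ i : Fin n, ∑ j : Fin n, V i j * m j ≤ ∑ j : Fin n, V i j * a j) →
    (∀ i : Fin n, ∃ a ∈ A, ∀ i' : Fin n,
      ∑ j : Fin n, V i' j * a j = ∑ j : Fin n, V i' j * m j + (if i' = i then 1 else 0)) →
    ∀ (f : MvPolynomial (Fin n) k) (d : Fin n →₀ ℕ) (g : MvPolynomial (Fin n) k), (Ideal.span {f}).IsPrime →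
    (∀ j : Fin n, Ideal.Quotient.mk (Ideal.span {f}) (MvPolynomial.X j) ≠ 0) →
    MvPolynomial.aeval (fun j : Fin n => ∏ i : Fin n, (MvPolynomial.X i : MvPolynomial (Fin n) k) ^ V i j) f = MvPolynomial.monomial d 1 * g →
    (∀ i : Fin n, ¬ (MvPolynomial.X i ∣ g)) →
    ∃ e : (MvPolynomial (Fin n) k ⧸ Ideal.span {g}) ≃+* ↥(blowupAlgebra ((Ideal.span ((fun b : Fin n →₀ ℕ => (MvPolynomial.monomial b (1 : k) : MvPolynomial (Fin n) k)) '' (A : Set (Fin n →₀ ℕ)))).map (Ideal.Quotient.mk (Ideal.span {f}))) (Ideal.Quotient.mk (Ideal.span {f}) (MvPolynomial.monomial m 1))),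
      ∀ j : Fin n, ((e (Ideal.Quotient.mk (Ideal.span {g}) (∏ i : Fin n, MvPolynomial.X i ^ V i j))) :
          Localization.Away (Ideal.Quotient.mk (Ideal.span {f}) (MvPolynomial.monomial m (1 : k)))) =
        algebraMap (MvPolynomial (Fin n) k ⧸ Ideal.span {f}) (Localization.Away (Ideal.Quotient.mk (Ideal.span {f}) (MvPolynomial.monomial m (1 : k))))
          (Ideal.Quotient.mk (Ideal.span {f}) (MvPolynomial.X j)) := by
  intro k _ n A V hV m hm hge hgen f d g hprime hXne hg hcop
  classical
  -- choose the chart exponents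
  choose a haA ha using hgen
  have hgen' : ∀ i : Fin n, (Finsupp.equivFunOnFinite.symm (V.mulVec ⇑(a i)) : Fin n →₀ ℕ) =
      Finsupp.equivFunOnFinite.symm (V.mulVec ⇑m) + Finsupp.single i 1 := by
    intro i
    ext i'
    simp only [Finsupp.coe_equivFunOnFinite_symm, Finsupp.add_apply, Matrix.mulVec, dotProduct,
      Finsupp.single_eq_pi_single, Pi.single_apply, ha i i']
  have hge' : ∀ e ∈ A, (Finsupp.equivFunOnFinite.symm (V.mulVec ⇑m) : Fin n →₀ ℕ) ≤
      Finsupp.equivFunOnFinite.symm (V.mulVec ⇑e) := by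
    intro e he i
    simp only [Finsupp.coe_equivFunOnFinite_symm, Matrix.mulVec, dotProduct]
    exact hge e he i
  obtain ⟨e₁, hbij, hθ⟩ := exists_monomialChartPresentation_of_isPrime f V hV m a hgen' A haA hge' d g hg hprime hXne hcop
  -- the two spellings of the ideal `(x^A)·R̄`
  have hI : Ideal.span ((fun e : Fin n →₀ ℕ => Ideal.Quotient.mk (Ideal.span {f}) (MvPolynomial.monomial e (1 : k))) '' (A : Set _)) =
      (Ideal.span ((fun b : Fin n →₀ ℕ => (MvPolynomial.monomial b (1 : k) : MvPolynomial (Fin n) k)) '' (A : Set (Fin n →₀ ℕ)))).map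
        (Ideal.Quotient.mk (Ideal.span {f})) := by
    rw [Ideal.map_span, Set.image_image]
  have hB : blowupAlgebra (Ideal.span ((fun e : Fin n →₀ ℕ => Ideal.Quotient.mk (Ideal.span {f}) (MvPolynomial.monomial e (1 : k))) ''
      (A : Set _))) (Ideal.Quotient.mk (Ideal.span {f}) (MvPolynomial.monomial m 1)) =
      blowupAlgebra ((Ideal.span ((fun b : Fin n →₀ ℕ => (MvPolynomial.monomial b (1 : k) : MvPolynomial (Fin n) k)) ''
        (A : Set (Fin n →₀ ℕ)))).map (Ideal.Quotient.mk (Ideal.span {f}))) (Ideal.Quotient.mk (Ideal.span {f}) (MvPolynomial.monomial m 1)) := by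
    rw [hI]
  -- transport along the inclusion of the (equal) blow-up algebras
  have hbij₂ : Function.Bijective ((Subalgebra.inclusion hB.le).toRingHom.comp e₁) := by
    refine ⟨(Subalgebra.inclusion_injective hB.le).comp hbij.1, fun y => ?_⟩
    obtain ⟨x, hx⟩ := hbij.2 ⟨y.1, by rw [hB]; exact y.2⟩
    exact ⟨x, Subtype.ext (by rw [RingHom.comp_apply, AlgHom.toRingHom_eq_coe, RingHom.coe_coe, Subalgebra.coe_inclusion, hx])⟩
  refine ⟨RingEquiv.ofBijective _ hbij₂, fun j => ?_⟩
  have h := hθ (MvPolynomial.X j)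
  rw [MvPolynomial.aeval_X] at h
  rw [RingEquiv.ofBijective_apply, RingHom.comp_apply, AlgHom.toRingHom_eq_coe, RingHom.coe_coe, Subalgebra.coe_inclusion]
  exact h

end Summit.ResolutionOfSingularities.ResolutionOfSingularities.Theorems.FInjectiveMacaulayfication.MonomialChartPresentationPrime

end
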